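import Summits.HodgeConjecture.HodgeConjecture.Theorems.Ring2HypothesesDescentLefschetzBAlgebraicDegrees
import Summits.HodgeConjecture.HodgeConjecture.Theorems.NoetherLefschetzOneUpSummitGrantedFourfoldsCohomologicallyAlgebraicTransferSymm
import Summits.HodgeConjecture.HodgeConjecture.Theorems.BoundaryReadoutPullbackAlgebraic
import Literature.AlgebraicGeometry.HodgeTheory.GysinBaseChange
import Literature.AlgebraicGeometry.HodgeTheory.AlgebraicClassesExteriorProduct
import Literature.AlgebraicGeometry.HodgeTheory.HardLefschetzNFoldHolds
import Literature.AlgebraicGeometry.HodgeTheory.SupportedClassesRationalProofs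
import Literature.AlgebraicGeometry.HodgeTheory.LefschetzOneOneHolds
import Literature.AlgebraicGeometry.HodgeTheory.HodgeTypeExteriorProduct
import Literature.AlgebraicGeometry.HodgeTheory.ComplexConjugation
import HarnessLib

/-!
# Rational `(2,2)`-classes on the square `X × X` of a smooth projective threefold — the REGULAR `h^{2,0} = 0`
# locus, and product threefolds `S × C` (cell `hodge-nonav`, sector SQ3, rows SQ3-reg / SQ3-prod)

PROVENANCE. Cell hodge-nonav (HUMAN RULING D-0038), planner seat p1 g21: memo `HOME/memos/ROUTE-P1T.md`, frozen sketch
`HOME/p1/route/Sketch_P1T_SQ3_g21.lean` = `HOME/memos/ROUTE-P1T-Sketch.lean` (sha16 17f9dc68211263eb, 539 lines, namespace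
`HodgeNonAV.P1T`, farm rc 0 / 0 sorries, re-elaborated 2026-08-28) §3 + §4, landed by the prover seat `hodge-nonav-20241-p1`
(g10) on the planner's assignment T1 (p1 g35, STATUS 2026-08-28T05:21:56Z, ask A20-a of the memo §6) with
`--supports stmt-HodgeConjecture-19654 --as helper` (SectorComplement evidence, product sector). Proof bodies verbatim; the
sketch's pointwise abbreviation `HC22sq X` is SPELLED OUT as the body of the tree Prop
`LefschetzStandardShadows.HodgeCodimTwoSquaresOfThreefolds` (file `Theorems/LefschetzStandardShadows`) at the given `X`
(no new definition); the sketch's auxiliary morphisms `shuffle`, `sectionAt`, `projSq` are inlined into the two proofs of §2.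

CONTENT (all sorry-free over tree theorems; no definition, no named fact, no new axiom):

* §1 (row SQ3-reg, KERNEL). `algebraicClasses_tensor_eq_top_of_slots` — Künneth slot lemma: if for every splitting
  `i + j = 2p` one factor `Hⁱ(Y)`/`Hʲ(Z)` vanishes or both are even and spanned by algebraic classes, then `H^{2p}(Y × Z)` is
  spanned by algebraic classes (`kunnethSpan_complexBetti` + `cupProduct_map_fst_map_snd_mem_supportedClasses`);
  `subsingleton_complexBetti_five` (`b₁ = 0 ⇒ H⁵ = 0`, hard Lefschetz); `algebraicClasses_two_eq_top_of_forall_isOfHodgeType`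
  (`h^{3,1} = 0 ⇒ H⁴(X) = N²`, HC in dimension `≤ 3`); `algebraicClasses_sq_two_eq_top` — **for a smooth projective threefold
  with `b₁ = 0`, `H² = N¹H²`, `H⁴ = N²H⁴`, EVERY class of `H⁴(X × X; ℂ)` is algebraic** (no hypothesis on `H³(X)`: Fano and
  Calabi–Yau threefolds, regular threefolds with `p_g`-type vanishing in degree 2, complete-intersection threefolds); hence the
  rational `(2,2)`-classes of `X × X` are algebraic on that locus (`hodgeTwoTwo_sq_of_regular_h20_zero`, `…_of_hodgeTypes`).
* §2 (row SQ3-prod, KERNEL). `hodgeConjectureFor_sq_surface_times_curve`: `HC(S × S) ⟹ HC((S × C) × (S × C))` for a smooth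
  projective surface `S` and a smooth projective curve `C` with `b₁(C) = 0` (transfer along the cohomologically algebraic factor
  `C × C`, `CohomologicallyAlgebraic.hodgeConjectureFor_tensor_of_left`, then the shuffle isomorphism); conversely
  `hodgeTwoTwo_sq_surface_of_hodgeTwoTwo_sq_timesCurve`: the rational `(2,2)`-classes of `S × S` are algebraic as soon as those
  of `(S × C) × (S × C)` are, for any POINTED smooth projective curve `C` (pull back along `fst × fst`, restrict to the section
  at the point; `fulton1998_map_mem_algebraicClasses_holds`). So for `X = S × ℙ¹` with `S` a K3 surface the square's codimension-2
  Hodge classes are exactly as hard as `HC⁴(S × S)`, although `B(X)` is known (Tankeev: `κ(X) < 3`).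

HONEST SCOPE. Structure theorems inside the Lefschetz/known region plus reductions; nothing here proves the Hodge conjecture for a
new variety; rung F-H1 not moved.

## References

* [VoisinHodgeI2002] C. Voisin, Hodge Theory and Complex Algebraic Geometry I (2002), Thm. 6.25, Thm. 11.30, §11.3.3 Lemma 11.41.
* [VoisinHodgeII2003] C. Voisin, Hodge Theory and Complex Algebraic Geometry II (2003), proof of Prop. 9.20.
* [HatcherAT2002] A. Hatcher, Algebraic Topology (2002), §3.2 Thm. 3.15 (Künneth).
* [Fulton1998] W. Fulton, Intersection Theory (1998), §19.1–19.2.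
-/

set_option linter.dupNamespace false

noncomputable section

open CategoryTheory AlgebraicGeometry MonoidalCategory CartesianMonoidalCategory
open Literature.AlgebraicTopology.SingularHomology
open Literature.AlgebraicGeometry Literature.AlgebraicGeometry.Motives Literature.AlgebraicGeometry.HodgeTheory
open Summit.HodgeConjecture.HodgeConjecture.Theorems
open Summit.HodgeConjecture.HodgeConjecture.Theorems.CohomologicallyAlgebraic

namespace Summit.HodgeConjecture.HodgeConjecture.Theorems.ThreefoldSquare

variable {m n d : ℕ} {X Y Z S C : SchemeOver ℂ}

/-! ## §1 The regular `h^{2,0} = 0` locus: every class of `H⁴(X × X)` is algebraic -/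

/-- **Künneth slot lemma**: if for every splitting `i + j = 2p` one factor `Hⁱ(Y)` / `Hʲ(Z)` vanishes or both are even
and spanned by algebraic classes, then `H^{2p}(Y × Z)` is spanned by algebraic classes (Künneth spanning
`kunnethSpan_complexBetti` + exterior products of algebraic classes `cupProduct_map_fst_map_snd_mem_supportedClasses`).
[cite: HatcherAT2002, §3.2 Thm. 3.15] [cite: VoisinHodgeII2003, proof of Prop. 9.20 (first display)] -/
theorem algebraicClasses_tensor_eq_top_of_slots (hY : IsSmoothProjective m Y)
    (hZ : IsSmoothProjective n Z) (p : ℕ)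
    (h : ∀ i j : ℕ, i + j = 2 * p →
      Subsingleton (complexBetti Y i) ∨ Subsingleton (complexBetti Z j) ∨
        ∃ l k : ℕ, i = 2 * l ∧ j = 2 * k ∧ algebraicClasses Y l = ⊤ ∧ algebraicClasses Z k = ⊤) :
    algebraicClasses (Y ⊗ Z) p = ⊤ := by
  refine eq_top_iff.2 fun z _ ↦ ?_
  refine (Submodule.span_le.2 ?_) (kunnethSpan_complexBetti hY hZ (2 * p) z)
  rintro v ⟨i, j, hij, b, w, rfl⟩
  rcases h i j hij with hi | hj | ⟨l, k, rfl, rfl, hl, hk⟩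
  · rw [Subsingleton.elim b 0, map_zero, LinearMap.map_zero₂]
    exact Submodule.zero_mem _
  · rw [Subsingleton.elim w 0, map_zero, map_zero]
    exact Submodule.zero_mem _
  · have hb : b ∈ supportedClasses Y (2 * l) l := by
      change b ∈ algebraicClasses Y l
      rw [hl]; exact Submodule.mem_top
    have hw : w ∈ supportedClasses Z (2 * k) k := by
      change w ∈ algebraicClasses Z k
      rw [hk]; exact Submodule.mem_top
    have hc := cupProduct_map_fst_map_snd_mem_supportedClasses hY hZ hij hb hw
    obtain rfl : p = l + k := by omega
    exact hc

/-- **`H⁵(X) = 0` for a threefold with `b₁ = 0`** (hard Lefschetz `L² : H¹ ≅ H⁵`). [cite: VoisinHodgeI2002, Thm. 6.25] -/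
theorem subsingleton_complexBetti_five (hX : IsSmoothProjective 3 X)
    (h₁ : Subsingleton (complexBetti X 1)) : Subsingleton (complexBetti X 5) := by
  obtain ⟨Λ⟩ := nonempty_hardLefschetzNFold_holds 3 X hX
  exact (Λ.bijective_L (j := 2) (k := 1) (by norm_num) 5 (by norm_num)).2.subsingleton

/-- **`H⁴(X) = N²H⁴` for a threefold all of whose rational degree-4 classes are of type `(2,2)`** (`h^{3,1} = h^{2,0} = 0`):
rational classes span, and rational `(2,2)`-classes on a threefold are algebraic (HC in dimension `≤ 3`,
`hodgeClasses_algebraic_of_dim_le_three_holds`). [cite: VoisinHodgeI2002, Thm. 11.30 and §11.3] -/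
theorem algebraicClasses_two_eq_top_of_forall_isOfHodgeType (hX : IsSmoothProjective 3 X)
    (h22 : ∀ c : complexBetti X (2 * 2), IsRationalClass c → IsOfHodgeType 3 X (2 * 2) 2 2 c) :
    algebraicClasses X 2 = ⊤ := by
  refine eq_top_iff.2 ?_
  rw [← span_isRationalClass_eq_top_of_isSmoothProjective_holds 3 X hX (2 * 2)]
  exact Submodule.span_le.2 fun c hc ↦
    hodgeClasses_algebraic_of_dim_le_three_holds le_rfl hX 2 c hc (h22 c hc)

/-- **ROW SQ3-reg (KERNEL): for a smooth projective threefold with `b₁ = 0`, `H² = N¹H²` and `H⁴ = N²H⁴` (i.e.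
`h^{1,0} = h^{2,0} = 0`), EVERY class of `H⁴(X × X; ℂ)` is algebraic.** No hypothesis on `H³(X)` (any `h^{3,0}`, `h^{2,1}`): Fano
threefolds, Calabi–Yau threefolds, regular threefolds of general type with `p_g`-type vanishing in degree 2, complete-intersection
threefolds. (statement: cell hodge-nonav ROUTE-P1T row SQ3-reg; a corollary of Künneth + HC in dimension `≤ 3`)
[cite: VoisinHodgeII2003, proof of Prop. 9.20] [cite: VoisinHodgeI2002, Thm. 11.30] -/
theorem algebraicClasses_sq_two_eq_top (hX : IsSmoothProjective 3 X)
    (h₁ : Subsingleton (complexBetti X 1)) (h₂ : algebraicClasses X 1 = ⊤)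
    (h₄ : algebraicClasses X 2 = ⊤) : algebraicClasses (X ⊗ X) 2 = ⊤ := by
  refine algebraicClasses_tensor_eq_top_of_slots hX hX 2 fun i j hij ↦ ?_
  have hij' : i ≤ 4 := by omega
  interval_cases i
  · exact Or.inr (Or.inr ⟨0, 2, rfl, by omega, algebraicClasses_zero, h₄⟩)
  · exact Or.inl h₁
  · exact Or.inr (Or.inr ⟨1, 1, rfl, by omega, h₂, h₂⟩)
  · obtain rfl : j = 1 := by omega
    exact Or.inr (Or.inl h₁)
  · exact Or.inr (Or.inr ⟨2, 0, rfl, by omega, h₄, algebraicClasses_zero⟩)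

/-- **The rational `(2,2)`-classes of `X × X` are algebraic on the regular `h^{2,0} = 0` locus (KERNEL)** — the body of
`LefschetzStandardShadows.HodgeCodimTwoSquaresOfThreefolds` at this `X` (row S19 on the locus SQ3-reg).
[cite: VoisinHodgeII2003, proof of Prop. 9.20] -/
theorem hodgeTwoTwo_sq_of_regular_h20_zero (hX : IsSmoothProjective 3 X)
    (h₁ : Subsingleton (complexBetti X 1)) (h₂ : algebraicClasses X 1 = ⊤) (h₄ : algebraicClasses X 2 = ⊤) :
    ∀ c : complexBetti (X ⊗ X) (2 * 2), IsRationalClass c →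
      IsOfHodgeType (3 + 3) (X ⊗ X) (2 * 2) 2 2 c → c ∈ algebraicClasses (X ⊗ X) 2 := fun c _ _ ↦ by
  rw [algebraicClasses_sq_two_eq_top hX h₁ h₂ h₄]; exact Submodule.mem_top

/-- Hodge-number form of the same row: `b₁ = 0`, every rational degree-2 class of type `(1,1)`, every rational degree-4 class
of type `(2,2)` ⟹ the rational `(2,2)`-classes of `X × X` are algebraic. [cite: VoisinHodgeI2002, Thm. 11.30]
[cite: VoisinHodgeII2003, proof of Prop. 9.20] -/
theorem hodgeTwoTwo_sq_of_hodgeTypes (hX : IsSmoothProjective 3 X) (h₁ : Subsingleton (complexBetti X 1))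
    (h11 : ∀ c : complexBetti X (2 * 1), IsRationalClass c → IsOfHodgeType 3 X (2 * 1) 1 1 c)
    (h22 : ∀ c : complexBetti X (2 * 2), IsRationalClass c → IsOfHodgeType 3 X (2 * 2) 2 2 c) :
    ∀ c : complexBetti (X ⊗ X) (2 * 2), IsRationalClass c →
      IsOfHodgeType (3 + 3) (X ⊗ X) (2 * 2) 2 2 c → c ∈ algebraicClasses (X ⊗ X) 2 :=
  hodgeTwoTwo_sq_of_regular_h20_zero hX h₁ (algebraicClasses_one_eq_top_of_forall_isOfHodgeType hX h11)
    (algebraicClasses_two_eq_top_of_forall_isOfHodgeType hX h22)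

/-! ## §2 Product threefolds `X = S × C` with `b₁(C) = 0`: `HC(X × X)` is exactly as hard as `HC(S × S)` -/

/-- **ROW SQ3-prod (KERNEL): `HC(S × S) ⟹ HC((S × C) × (S × C))` for a smooth projective surface `S` and a smooth
projective curve `C` with `b₁(C) = 0`** (transfer along the cohomologically algebraic factor `C × C`
(`CohomologicallyAlgebraic.hodgeConjectureFor_tensor_of_left`), then the shuffle isomorphism
`(S × C) × (S × C) ≅ (S × S) × (C × C)` of the cartesian product). E.g. `X = K3 × ℙ¹`, `X = (p_g > 0 surface) × ℙ¹`: `B(X)` is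
known (Tankeev: `κ(X) < 3`) while the codimension-2 Hodge classes of `X × X` are exactly `HC⁴(S × S)`.
[cite: VoisinHodgeI2002, §11.3.3 Lemma 11.41] [cite: VoisinHodgeII2003, proof of Prop. 9.20] -/
theorem hodgeConjectureFor_sq_surface_times_curve (hS : IsSmoothProjective 2 S)
    (hC : IsSmoothProjective 1 C) (hb₁ : Subsingleton (complexBetti C 1))
    (hSS : HodgeConjectureFor 4 (S ⊗ S)) : HodgeConjectureFor 6 ((S ⊗ C) ⊗ (S ⊗ C)) := by
  have hSS' : IsSmoothProjective 4 (S ⊗ S) := IsSmoothProjective.tensor_holds hS hS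
  have hCC : IsSmoothProjective 2 (C ⊗ C) := IsSmoothProjective.tensor_holds hC hC
  have hSC : IsSmoothProjective 3 (S ⊗ C) := IsSmoothProjective.tensor_holds hS hC
  have hev : ∀ k, algebraicClasses (C ⊗ C) k = ⊤ :=
    algebraicClasses_tensor_eq_top hC hC (algebraicClasses_eq_top_curve hC)
      (subsingleton_complexBetti_odd_curve hC hb₁) (algebraicClasses_eq_top_curve hC)
      (subsingleton_complexBetti_odd_curve hC hb₁)
  have hodd : ∀ k, Subsingleton (complexBetti (C ⊗ C) (2 * k + 1)) :=
    subsingleton_complexBetti_tensor_odd hC hC (subsingleton_complexBetti_odd_curve hC hb₁)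
      (subsingleton_complexBetti_odd_curve hC hb₁)
  have h := hodgeConjectureFor_tensor_of_left hSS' hCC hev hodd hSS
  -- the shuffle `(S × C) × (S × C) ≅ (S × S) × (C × C)` of the cartesian product
  let shuffle : (S ⊗ C) ⊗ (S ⊗ C) ≅ (S ⊗ S) ⊗ (C ⊗ C) :=
    { hom := lift (lift (fst _ _ ≫ fst _ _) (snd _ _ ≫ fst _ _)) (lift (fst _ _ ≫ snd _ _) (snd _ _ ≫ snd _ _))
      inv := lift (lift (fst _ _ ≫ fst _ _) (snd _ _ ≫ fst _ _)) (lift (fst _ _ ≫ snd _ _) (snd _ _ ≫ snd _ _))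
      hom_inv_id := by ext <;> simp
      inv_hom_id := by ext <;> simp }
  exact hodgeConjectureFor_of_iso shuffle (IsSmoothProjective.tensor_holds hSS' hCC)
    (IsSmoothProjective.tensor_holds hSC hSC) h

/-- **ROW SQ3-prod, converse (KERNEL): if the rational `(2,2)`-classes of `(S × C) × (S × C)` are algebraic then so are
those of `S × S`**, for any pointed smooth projective curve `C`: pull back along `π = fst × fst`, use the hypothesis,
restrict to the section `S × {p} × S × {p}` (pull-backs preserve rationality, Hodge type and — Fulton Cor. 19.2 (b), tree
`fulton1998_map_mem_algebraicClasses_holds` — algebraicity). Hence for `S` a K3 surface with real multiplication the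
codimension-2 Hodge classes of `(S × ℙ¹)²` are OPEN exactly as `HC⁴(S × S)`, although `B(S × ℙ¹)` is known.
[cite: Fulton1998, §19.2 Cor. 19.2 (b)] [cite: VoisinHodgeI2002, §11.3.3 Lemma 11.41] -/
theorem hodgeTwoTwo_sq_surface_of_hodgeTwoTwo_sq_timesCurve (hS : IsSmoothProjective 2 S) (hC : IsSmoothProjective 1 C)
    (p : 𝟙_ (SchemeOver ℂ) ⟶ C)
    (h : ∀ c : complexBetti ((S ⊗ C) ⊗ (S ⊗ C)) (2 * 2), IsRationalClass c →
      IsOfHodgeType (3 + 3) ((S ⊗ C) ⊗ (S ⊗ C)) (2 * 2) 2 2 c → c ∈ algebraicClasses ((S ⊗ C) ⊗ (S ⊗ C)) 2)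
    (c : complexBetti (S ⊗ S) (2 * 2)) (hc : IsRationalClass c) (hH : IsOfHodgeType (2 + 2) (S ⊗ S) (2 * 2) 2 2 c) :
    c ∈ algebraicClasses (S ⊗ S) 2 := by
  have hSS : IsSmoothProjective (2 + 2) (S ⊗ S) := IsSmoothProjective.tensor_holds hS hS
  have hSC : IsSmoothProjective 3 (S ⊗ C) := IsSmoothProjective.tensor_holds hS hC
  have hXX : IsSmoothProjective (3 + 3) ((S ⊗ C) ⊗ (S ⊗ C)) := IsSmoothProjective.tensor_holds hSC hSC
  letI := hSS.chartedSpace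
  -- `π = fst × fst : (S × C) × (S × C) ⟶ S × S` and the section `S × S ⟶ (S × C) × (S × C)` at `p`
  let projSq : (S ⊗ C) ⊗ (S ⊗ C) ⟶ S ⊗ S := lift (fst _ _ ≫ fst _ _) (snd _ _ ≫ fst _ _)
  let sectionAt : S ⊗ S ⟶ (S ⊗ C) ⊗ (S ⊗ C) :=
    lift (fst _ _ ≫ lift (𝟙 S) (toUnit S ≫ p)) (snd _ _ ≫ lift (𝟙 S) (toUnit S ≫ p))
  have hsec : sectionAt ≫ projSq = 𝟙 (S ⊗ S) := by
    ext <;> simp [sectionAt, projSq]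
  -- pull back to the sixfold
  have hπc : complexBetti.map projSq (2 * 2) c ∈ algebraicClasses ((S ⊗ C) ⊗ (S ⊗ C)) 2 :=
    h _ (hc.map (AlgPoints.mapContinuous (L := ℂ) projSq))
      (hH.map_of_isSmoothProjective hXX hSS projSq)
  -- restrict to the section
  have hsec' := fulton1998_map_mem_algebraicClasses_holds sectionAt hXX hSS 2 _ hπc
  rwa [← CategoryTheory.comp_apply, ← complexBetti.map_comp, hsec,
    complexBetti.map_id, CategoryTheory.id_apply] at hsec'

end Summit.HodgeConjecture.HodgeConjecture.Theorems.ThreefoldSquare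

end
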